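/-
Copyright (c) 2026. All rights reserved.
Released under Apache 2.0 license as described in the file LICENSE.
Authors: HodgeCM publication cell (pub-hodgecm), floor-0 programme P4 (engine E-2), prover `A-p12`.
-/
import Literature.NumberTheory.Weil1964.AdelicDoublingGeometricFrame
import Literature.NumberTheory.Weil1964.AdelicDoublingDeltaVectors
import HarnessLib

/-!
# The geometric frame of the doubling diagonal, II: the Borel of the doubled `W`-member through `𝐫₀`
# (unipotent translates act by chirps, torus translates act — in the frame — by pure twists)

Topic `NumberTheory/Weil1964`; namespace `Literature.NumberTheory.Weil1964`.  KERNEL MATHEMATICS ONLY: theorems over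
existing tree declarations; no definition, no `def … : Prop`, no `axiom`, no proof hole.  Sequel of
★ `AdelicDoublingGeometricFrame` (Li's `δ`, the frame matrix `C₀ = frameHalfRat`, the operator law for the
`V`-DIAGONAL `δ g^Δ δ⁻¹`) and ★ `AdelicDoublingDeltaVectors` (`δ`, `δ⁻¹` on vectors); cell `hodgecm-mathlib`,
floor-0 line P4, engine E-2, sheet `SW2c-BOUND-ASSEMBLY.v0` rows (L-N), (L-D).

THE MATHEMATICS ([Weil1964, Chap. I n° 13]: Weil's `𝐫₀` on the Siegel parabolic `P_𝕐`, `d₀(α)` acts by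
`Φ ↦ Φ ∘ α⁻¹`, `t₀(f)` by multiplication by the second-degree character `f`; [Weil1965, n° 46–50]: the Borel
`B = N·D` of the small group acts on the Siegel sections through exactly these two shapes; [Kudla1994, §3],
[GelbartPiatetskishapiroRallis1987, Part A §2], [Li1992, p. 181]: the doubling embedding `W ⊕ W⁻`, the diagonal
Lagrangian `W^Δ`, the anti-diagonal `W^∇`).  In the doubled space `𝕎□ = W ⊕ W⁻` of a symplectic space
`W = X ⊕ Y` (Gram matrix `T`, doubled Gram matrix `T ⊕ (−T)`), an element `g ∈ Sp(𝕎□)` of the `W`-member of the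
doubled dual pair acts on the two summands through `E`-SCALARS — maps `(x, y) ↦ (p x + d q y, q x + p y)`
(`p + q√d ∈ E = F(√d)`, [GelbartRogawski1991, §3.1]).  Two shapes matter for the Borel of `U(W□)` at the isotropic
line `W^Δ`:
* the UNIPOTENT shape (`n(β)`: fixes `W^Δ` pointwise and translates `W^∇` into `W^Δ` by the trace-zero scalar `b√d`):
  `g(w₁, w₂) = (w₁ + ε(w₁ − w₂), w₂ + ε(w₁ − w₂))`, `ε(x, y) = (d b y, b x)`;
* the TORUS shape (`d(t)`: the scalar `U = (p₁, q₁)` on `W^Δ`, the scalar `V = (p₂, q₂)` on `W^∇`, `U V̄ = 1`):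
  `g(w₁, w₂) = (½(U(w₁ + w₂) + V(w₁ − w₂)), ½(U(w₁ + w₂) − V(w₁ − w₂)))`.
Both stabilise `W^Δ` (★ `stabDiag`), so Li's `δ` conjugates them into the Siegel parabolic `P_𝕐` of `𝕐 = δ W^Δ`
(★ `stabDiagParabolic`, ★ `siegelParabolicPiReindex`) and Weil's `𝐫₀` (★ `adelicSiegelLift`) lifts them.  We compute
`p⁻¹(x, 0)` for `p = δ g δ⁻¹` in closed form (§1, any commutative ring) and read off, through
★ `coe_toOp_adelicSiegelLift_symm` (`(ω(𝐫₀ p)Φ)(x) = ψ(½ β(u, v)) Φ(u)`, `(u, v) = p⁻¹(x, 0)`), the OPERATOR LAWS (§2,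
adelic, renumbered by `finSumFinEquiv` as in ★ `AdelicDoublingGeometricFrame` §2):
* (L-N) `ω(𝐫₀(δ n δ⁻¹)) Φ = chirp S_b Φ` with `q_{S_b}(x) = ½ b (x|₁ ⋅ T x|₁ − d x|₂ ⋅ T⁻¹ x|₂)` — a chirp, which
  commutes with the frame chirp `t(C₀)`: the same law holds in the frame `Φ♮ = t(C₀) Φ`;
* (L-D) `t(C₀) (ω(𝐫₀(δ d δ⁻¹)) Φ) = (t(C₀) Φ) ∘ (M_V ·)` with `M_V = [[p₂, d q₂ T⁻¹], [q₂ T, p₂]]` (the `∇`-scalar `V`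
  of `d⁻¹` in the Darboux coordinates of `𝕏`): IN THE FRAME THE TORUS ACTS BY A PURE TWIST — no chirp, no phase —
  because the second-degree character of `δ d δ⁻¹` is the COBOUNDARY `½(q(M_V x) − q(x))` of `q(z) = z|₁ ⋅ z|₂`
  (uses `U V̄ = 1` and `T` symmetric), exactly as for the `V`-diagonal in ★ `chirp_frameHalf_toOp_doublingParabolicFin`.
The `W`-side element enters ONLY through its action on vectors (hypotheses `hN`, `hD` below, stated for `g` and for
`g⁻¹`); identifying the pair embedding `ι(1 ⊗ n_U(β))`, `ι(1 ⊗ d_U(t))` of the doubled unitary group with such a `g`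
is the carrier files' business (★ `UnitaryDualPairDoubledLine*`, `adelicPairToSymplectic_…_apply`).

References: [Weil1964] A. Weil, Acta Math. 111 (1964), Chap. I n° 13 p. 160 (`𝐫₀`, `d₀`, `t₀`); [Weil1965] A. Weil,
Acta Math. 113 (1965), n° 46–50 (the Borel translates of the Siegel sections); [Kudla1994] S. S. Kudla, Israel J.
Math. 87 (1994), §3; [GelbartPiatetskishapiroRallis1987] LNM 1254, Part A §2 pp. 7–9; [Li1992] J.-S. Li, J. reine
angew. Math. 428 (1992), p. 181; [GelbartRogawski1991] Invent. Math. 105 (1991), §3.1 p. 455 (`E`-scalars on `Res(V ⊗ W)`).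
-/

set_option autoImplicit false

noncomputable section

namespace Literature.NumberTheory.Weil1964

open Literature.RepresentationTheory.HeisenbergGroup
open Literature.RepresentationTheory.HeisenbergGroup.SymplecticMatrix
open Literature.NumberTheory.Automorphic
open Literature.NumberTheory.Automorphic.UnitaryGroup (spReindex reindexW coe_spReindex_apply reindexW_apply
  reindexW_symm_apply toLinearMap₂'_reindex)
open NumberField
open scoped Matrix

/-! ## §1 Generic (any commutative ring): the two Borel shapes, `δ g δ⁻¹ ∈ P_𝕐`, and `(δ g δ⁻¹)⁻¹(x, 0)` in closed form -/

section Generic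

variable {K : Type*} [CommRing K] {ι : Type*} [Fintype ι] [DecidableEq ι] (T : Matrix ι ι K) (hT : IsUnit T.det)
  (g : symplecticGroup (polar (Matrix.toLinearMap₂' K (Matrix.fromBlocks T 0 0 (-T)))))

/-- An element mapping diagonal vectors `((x,x),(y,y))` to diagonal vectors, in both directions, stabilises `W^Δ`
(★ `stabDiag`). [cite: GelbartPiatetskishapiroRallis1987, Part A §2 pp. 7–9] -/
theorem mem_stabDiag_of_apply_diag
    (h₁ : ∀ x y : ι → K, IsDiag (((g : symplecticGroup (polar (Matrix.toLinearMap₂' K (Matrix.fromBlocks T 0 0 (-T))))) :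
        ((ι ⊕ ι → K) × (ι ⊕ ι → K)) ≃ₗ[K] ((ι ⊕ ι → K) × (ι ⊕ ι → K))) (Sum.elim x x, Sum.elim y y)))
    (h₂ : ∀ x y : ι → K, IsDiag (((g : symplecticGroup (polar (Matrix.toLinearMap₂' K (Matrix.fromBlocks T 0 0 (-T))))) :
        ((ι ⊕ ι → K) × (ι ⊕ ι → K)) ≃ₗ[K] ((ι ⊕ ι → K) × (ι ⊕ ι → K))).symm (Sum.elim x x, Sum.elim y y))) :
    g ∈ stabDiag T :=
  ⟨fun v hv => by rw [hv.eq]; exact h₁ _ _, fun v hv => by rw [hv.eq]; exact h₂ _ _⟩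

/-- `(δ g δ⁻¹)⁻¹ v = δ (g⁻¹ (δ⁻¹ v))` (Li's `δ`-conjugation read on vectors). [cite: Li1992, p. 181] -/
theorem conj_doublingDelta_symm_apply (v : (ι ⊕ ι → K) × (ι ⊕ ι → K)) :
    ((doublingDelta T hT * g * (doublingDelta T hT)⁻¹ :
          symplecticGroup (polar (Matrix.toLinearMap₂' K (Matrix.fromBlocks T 0 0 (-T))))) :
        ((ι ⊕ ι → K) × (ι ⊕ ι → K)) ≃ₗ[K] ((ι ⊕ ι → K) × (ι ⊕ ι → K))).symm v =
      ((doublingDelta T hT : symplecticGroup (polar (Matrix.toLinearMap₂' K (Matrix.fromBlocks T 0 0 (-T))))) :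
          ((ι ⊕ ι → K) × (ι ⊕ ι → K)) ≃ₗ[K] ((ι ⊕ ι → K) × (ι ⊕ ι → K)))
        (((g : symplecticGroup (polar (Matrix.toLinearMap₂' K (Matrix.fromBlocks T 0 0 (-T))))) :
            ((ι ⊕ ι → K) × (ι ⊕ ι → K)) ≃ₗ[K] ((ι ⊕ ι → K) × (ι ⊕ ι → K))).symm
          (((doublingDelta T hT : symplecticGroup (polar (Matrix.toLinearMap₂' K (Matrix.fromBlocks T 0 0 (-T))))) :
              ((ι ⊕ ι → K) × (ι ⊕ ι → K)) ≃ₗ[K] ((ι ⊕ ι → K) × (ι ⊕ ι → K))).symm v)) := by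
  rw [show doublingDelta T hT * g * (doublingDelta T hT)⁻¹ = (doublingDelta T hT * g⁻¹ * (doublingDelta T hT)⁻¹)⁻¹ by group]
  change ((doublingDelta T hT * g⁻¹ * (doublingDelta T hT)⁻¹ :
          symplecticGroup (polar (Matrix.toLinearMap₂' K (Matrix.fromBlocks T 0 0 (-T))))) :
        ((ι ⊕ ι → K) × (ι ⊕ ι → K)) ≃ₗ[K] ((ι ⊕ ι → K) × (ι ⊕ ι → K))).symm.symm v = _
  rw [LinearEquiv.symm_symm]
  rfl

/-! ### The unipotent shape -/

section Unip

variable {b d : K}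

/-- **A unipotent-shape element stabilises the diagonal Lagrangian `W^Δ`** — it even fixes it pointwise, and so does
its inverse. [cite: Weil1965, n° 46 p. 66] [cite: GelbartPiatetskishapiroRallis1987, Part A §2 pp. 7–9] -/
theorem mem_stabDiag_of_unipShape
    (hN : ∀ x₁ x₂ y₁ y₂ : ι → K,
      ((g : symplecticGroup (polar (Matrix.toLinearMap₂' K (Matrix.fromBlocks T 0 0 (-T))))) :
          ((ι ⊕ ι → K) × (ι ⊕ ι → K)) ≃ₗ[K] ((ι ⊕ ι → K) × (ι ⊕ ι → K))) (Sum.elim x₁ x₂, Sum.elim y₁ y₂) =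
        (Sum.elim (x₁ + (d * b) • (y₁ - y₂)) (x₂ + (d * b) • (y₁ - y₂)),
          Sum.elim (y₁ + b • (x₁ - x₂)) (y₂ + b • (x₁ - x₂)))) :
    g ∈ stabDiag T := by
  have hfix : ∀ x y : ι → K,
      ((g : symplecticGroup (polar (Matrix.toLinearMap₂' K (Matrix.fromBlocks T 0 0 (-T))))) :
          ((ι ⊕ ι → K) × (ι ⊕ ι → K)) ≃ₗ[K] ((ι ⊕ ι → K) × (ι ⊕ ι → K))) (Sum.elim x x, Sum.elim y y) =
        (Sum.elim x x, Sum.elim y y) := fun x y => by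
    rw [hN]
    simp only [sub_self, smul_zero, add_zero]
  refine mem_stabDiag_of_apply_diag T g (fun x y => ?_) (fun x y => ?_)
  · rw [hfix]
    exact isDiag_diag x y
  · rw [((g : symplecticGroup (polar (Matrix.toLinearMap₂' K (Matrix.fromBlocks T 0 0 (-T))))) :
        ((ι ⊕ ι → K) × (ι ⊕ ι → K)) ≃ₗ[K] ((ι ⊕ ι → K) × (ι ⊕ ι → K))).symm_apply_eq.2 (hfix x y).symm]
    exact isDiag_diag x y

/-- **`(δ g δ⁻¹)⁻¹` ON `𝕏` FOR THE UNIPOTENT SHAPE**: if `g⁻¹` has the unipotent shape with parameter `b` then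
`(δ g δ⁻¹)⁻¹((x₁, x₂), 0) = ((x₁, x₂), (b x₁, d b T⁻¹T⁻¹ x₂))` — the `𝕏`-component is unchanged (`δ g δ⁻¹` is in the
unipotent radical of `P_𝕐`). [cite: Weil1964, Chap. I n° 13 p. 160] [cite: Li1992, p. 181] -/
theorem conj_doublingDelta_symm_apply_inl_of_unipShape
    (hN' : ∀ x₁ x₂ y₁ y₂ : ι → K,
      ((g : symplecticGroup (polar (Matrix.toLinearMap₂' K (Matrix.fromBlocks T 0 0 (-T))))) :
          ((ι ⊕ ι → K) × (ι ⊕ ι → K)) ≃ₗ[K] ((ι ⊕ ι → K) × (ι ⊕ ι → K))).symm (Sum.elim x₁ x₂, Sum.elim y₁ y₂) =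
        (Sum.elim (x₁ + (d * b) • (y₁ - y₂)) (x₂ + (d * b) • (y₁ - y₂)),
          Sum.elim (y₁ + b • (x₁ - x₂)) (y₂ + b • (x₁ - x₂))))
    (x₁ x₂ : ι → K) :
    ((doublingDelta T hT * g * (doublingDelta T hT)⁻¹ :
          symplecticGroup (polar (Matrix.toLinearMap₂' K (Matrix.fromBlocks T 0 0 (-T))))) :
        ((ι ⊕ ι → K) × (ι ⊕ ι → K)) ≃ₗ[K] ((ι ⊕ ι → K) × (ι ⊕ ι → K))).symm (Sum.elim x₁ x₂, 0) =
      (Sum.elim x₁ x₂, Sum.elim (b • x₁) ((d * b) • (T⁻¹ *ᵥ (T⁻¹ *ᵥ x₂)))) := by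
  rw [conj_doublingDelta_symm_apply, doublingDelta_symm_apply_inl, hN', doublingDelta_apply_sumElim]
  have e1 : x₁ + (d * b) • ((0 : ι → K) - -(T⁻¹ *ᵥ x₂)) - (0 + (d * b) • ((0 : ι → K) - -(T⁻¹ *ᵥ x₂))) = x₁ := by
    module
  have e2 : (0 : ι → K) + b • (x₁ - 0) - (-(T⁻¹ *ᵥ x₂) + b • (x₁ - 0)) = T⁻¹ *ᵥ x₂ := by module
  have e3 : (0 : ι → K) + b • (x₁ - 0) = b • x₁ := by module
  have e4 : (0 : ι → K) + (d * b) • ((0 : ι → K) - -(T⁻¹ *ᵥ x₂)) = (d * b) • (T⁻¹ *ᵥ x₂) := by module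
  rw [e1, e2, e3, e4, Matrix.mulVec_mulVec, Matrix.mul_nonsing_inv T hT, Matrix.one_mulVec, Matrix.mulVec_smul]

include hT in
/-- **THE SECOND-DEGREE CHARACTER OF `δ n δ⁻¹`**: with `(u, v) = (δ g δ⁻¹)⁻¹((x₁,x₂), 0)` as above,
`β_{T⊕−T}(u, v) = b·(x₁ ⋅ T x₁) − d b·(x₂ ⋅ T⁻¹ x₂)`. [cite: Weil1964, Chap. I n° 13 p. 160] -/
theorem form_unipShape (x₁ x₂ : ι → K) :
    Sum.elim x₁ x₂ ⬝ᵥ (Matrix.fromBlocks T 0 0 (-T) *ᵥ Sum.elim (b • x₁) ((d * b) • (T⁻¹ *ᵥ (T⁻¹ *ᵥ x₂)))) =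
      b * (x₁ ⬝ᵥ (T *ᵥ x₁)) - (d * b) * (x₂ ⬝ᵥ (T⁻¹ *ᵥ x₂)) := by
  rw [Matrix.fromBlocks_mulVec, Sum.elim_comp_inl, Sum.elim_comp_inr, Matrix.zero_mulVec, Matrix.zero_mulVec, add_zero,
    zero_add, sumElim_dotProduct_sumElim, Matrix.mulVec_smul, dotProduct_smul, Matrix.neg_mulVec, Matrix.mulVec_smul,
    Matrix.mulVec_mulVec, Matrix.mul_nonsing_inv T hT, Matrix.one_mulVec, dotProduct_neg, dotProduct_smul, smul_eq_mul,
    smul_eq_mul, sub_eq_add_neg]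

end Unip

/-! ### The torus shape -/

section Torus

variable [Invertible (2 : K)] {p₁ q₁ p₂ q₂ d : K}

omit [Fintype ι] [DecidableEq ι] in
/-- `⅟2 • (a + c) + ⅟2 • (a - c) = a` and friends: the two projections of the torus shape. [folklore] -/
private theorem half_add_half_sub (a c : ι → K) : (⅟(2 : K)) • (a + c) - (⅟(2 : K)) • (a - c) = c := by
  have h2 : (⅟(2 : K)) • (c + c) = c := by
    rw [← two_smul K c, smul_smul, invOf_mul_self, one_smul]
  rw [← smul_sub, show a + c - (a - c) = c + c by abel, h2]

/-- **A torus-shape element stabilises the diagonal Lagrangian `W^Δ`** (it acts on `W^Δ` by the scalar `U` and on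
`W^∇` by `V`; both directions are hypotheses, for `g` and for `g⁻¹`). [cite: Weil1965, n° 46 p. 66]
[cite: GelbartPiatetskishapiroRallis1987, Part A §2 pp. 7–9] -/
theorem mem_stabDiag_of_torusShape {p₁' q₁' p₂' q₂' : K}
    (hD : ∀ x₁ x₂ y₁ y₂ : ι → K,
      ((g : symplecticGroup (polar (Matrix.toLinearMap₂' K (Matrix.fromBlocks T 0 0 (-T))))) :
          ((ι ⊕ ι → K) × (ι ⊕ ι → K)) ≃ₗ[K] ((ι ⊕ ι → K) × (ι ⊕ ι → K))) (Sum.elim x₁ x₂, Sum.elim y₁ y₂) =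
        (Sum.elim ((⅟(2 : K)) • ((p₁' • (x₁ + x₂) + (d * q₁') • (y₁ + y₂)) + (p₂' • (x₁ - x₂) + (d * q₂') • (y₁ - y₂))))
            ((⅟(2 : K)) • ((p₁' • (x₁ + x₂) + (d * q₁') • (y₁ + y₂)) - (p₂' • (x₁ - x₂) + (d * q₂') • (y₁ - y₂)))),
          Sum.elim ((⅟(2 : K)) • ((q₁' • (x₁ + x₂) + p₁' • (y₁ + y₂)) + (q₂' • (x₁ - x₂) + p₂' • (y₁ - y₂))))
            ((⅟(2 : K)) • ((q₁' • (x₁ + x₂) + p₁' • (y₁ + y₂)) - (q₂' • (x₁ - x₂) + p₂' • (y₁ - y₂))))))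
    (hD' : ∀ x₁ x₂ y₁ y₂ : ι → K,
      ((g : symplecticGroup (polar (Matrix.toLinearMap₂' K (Matrix.fromBlocks T 0 0 (-T))))) :
          ((ι ⊕ ι → K) × (ι ⊕ ι → K)) ≃ₗ[K] ((ι ⊕ ι → K) × (ι ⊕ ι → K))).symm (Sum.elim x₁ x₂, Sum.elim y₁ y₂) =
        (Sum.elim ((⅟(2 : K)) • ((p₁ • (x₁ + x₂) + (d * q₁) • (y₁ + y₂)) + (p₂ • (x₁ - x₂) + (d * q₂) • (y₁ - y₂))))
            ((⅟(2 : K)) • ((p₁ • (x₁ + x₂) + (d * q₁) • (y₁ + y₂)) - (p₂ • (x₁ - x₂) + (d * q₂) • (y₁ - y₂)))),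
          Sum.elim ((⅟(2 : K)) • ((q₁ • (x₁ + x₂) + p₁ • (y₁ + y₂)) + (q₂ • (x₁ - x₂) + p₂ • (y₁ - y₂))))
            ((⅟(2 : K)) • ((q₁ • (x₁ + x₂) + p₁ • (y₁ + y₂)) - (q₂ • (x₁ - x₂) + p₂ • (y₁ - y₂)))))) :
    g ∈ stabDiag T := by
  refine mem_stabDiag_of_apply_diag T g (fun x y => ?_) (fun x y => ?_)
  · rw [hD]
    simp only [sub_self, smul_zero, add_zero, sub_zero]
    exact isDiag_diag _ _
  · rw [hD']
    simp only [sub_self, smul_zero, add_zero, sub_zero]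
    exact isDiag_diag _ _

/-- **`(δ g δ⁻¹)⁻¹` ON `𝕏` FOR THE TORUS SHAPE**: if `g⁻¹` has the torus shape (`U = (p₁, q₁)` on `W^Δ`,
`V = (p₂, q₂)` on `W^∇`) then `(δ g δ⁻¹)⁻¹((x₁, x₂), 0) = (u, v)` with `𝕏`-component
`u = M_V x = (p₂ x₁ + d q₂ T⁻¹ x₂, q₂ T x₁ + p₂ x₂)` (the scalar `V` in the Darboux coordinates `θ_T(c₁, c₂) = (c₁, T c₂)`
of `𝕏`) and `𝕐`-component `v = (½(U(x₁, −T⁻¹x₂) + V(x₁, T⁻¹x₂))₂, T⁻¹ · ½(U(x₁, −T⁻¹x₂) − V(x₁, T⁻¹x₂))₁)`.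
[cite: Weil1964, Chap. I n° 13 p. 160] [cite: Li1992, p. 181] -/
theorem conj_doublingDelta_symm_apply_inl_of_torusShape
    (hD' : ∀ x₁ x₂ y₁ y₂ : ι → K,
      ((g : symplecticGroup (polar (Matrix.toLinearMap₂' K (Matrix.fromBlocks T 0 0 (-T))))) :
          ((ι ⊕ ι → K) × (ι ⊕ ι → K)) ≃ₗ[K] ((ι ⊕ ι → K) × (ι ⊕ ι → K))).symm (Sum.elim x₁ x₂, Sum.elim y₁ y₂) =
        (Sum.elim ((⅟(2 : K)) • ((p₁ • (x₁ + x₂) + (d * q₁) • (y₁ + y₂)) + (p₂ • (x₁ - x₂) + (d * q₂) • (y₁ - y₂))))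
            ((⅟(2 : K)) • ((p₁ • (x₁ + x₂) + (d * q₁) • (y₁ + y₂)) - (p₂ • (x₁ - x₂) + (d * q₂) • (y₁ - y₂)))),
          Sum.elim ((⅟(2 : K)) • ((q₁ • (x₁ + x₂) + p₁ • (y₁ + y₂)) + (q₂ • (x₁ - x₂) + p₂ • (y₁ - y₂))))
            ((⅟(2 : K)) • ((q₁ • (x₁ + x₂) + p₁ • (y₁ + y₂)) - (q₂ • (x₁ - x₂) + p₂ • (y₁ - y₂))))))
    (x₁ x₂ : ι → K) :
    ((doublingDelta T hT * g * (doublingDelta T hT)⁻¹ :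
          symplecticGroup (polar (Matrix.toLinearMap₂' K (Matrix.fromBlocks T 0 0 (-T))))) :
        ((ι ⊕ ι → K) × (ι ⊕ ι → K)) ≃ₗ[K] ((ι ⊕ ι → K) × (ι ⊕ ι → K))).symm (Sum.elim x₁ x₂, 0) =
      (Sum.elim (p₂ • x₁ + (d * q₂) • (T⁻¹ *ᵥ x₂)) (q₂ • (T *ᵥ x₁) + p₂ • x₂),
        Sum.elim ((⅟(2 : K)) • ((q₁ • x₁ + p₁ • (-(T⁻¹ *ᵥ x₂))) + (q₂ • x₁ + p₂ • (T⁻¹ *ᵥ x₂))))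
          (T⁻¹ *ᵥ ((⅟(2 : K)) • ((p₁ • x₁ + (d * q₁) • (-(T⁻¹ *ᵥ x₂))) - (p₂ • x₁ + (d * q₂) • (T⁻¹ *ᵥ x₂)))))) := by
  rw [conj_doublingDelta_symm_apply, doublingDelta_symm_apply_inl, hD', doublingDelta_apply_sumElim,
    half_add_half_sub, half_add_half_sub]
  simp only [sub_zero, zero_sub, add_zero, zero_add, neg_neg, Matrix.mulVec_add, Matrix.mulVec_smul, Matrix.mulVec_mulVec,
    Matrix.mul_nonsing_inv T hT, Matrix.one_mulVec]

/-- the `𝕏`-component alone: `((δ g δ⁻¹)⁻¹((x₁, x₂), 0)).1 = M_V x`. [cite: Weil1964, Chap. I n° 13 p. 160] -/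
theorem fst_conj_doublingDelta_symm_apply_inl_of_torusShape
    (hD' : ∀ x₁ x₂ y₁ y₂ : ι → K,
      ((g : symplecticGroup (polar (Matrix.toLinearMap₂' K (Matrix.fromBlocks T 0 0 (-T))))) :
          ((ι ⊕ ι → K) × (ι ⊕ ι → K)) ≃ₗ[K] ((ι ⊕ ι → K) × (ι ⊕ ι → K))).symm (Sum.elim x₁ x₂, Sum.elim y₁ y₂) =
        (Sum.elim ((⅟(2 : K)) • ((p₁ • (x₁ + x₂) + (d * q₁) • (y₁ + y₂)) + (p₂ • (x₁ - x₂) + (d * q₂) • (y₁ - y₂))))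
            ((⅟(2 : K)) • ((p₁ • (x₁ + x₂) + (d * q₁) • (y₁ + y₂)) - (p₂ • (x₁ - x₂) + (d * q₂) • (y₁ - y₂)))),
          Sum.elim ((⅟(2 : K)) • ((q₁ • (x₁ + x₂) + p₁ • (y₁ + y₂)) + (q₂ • (x₁ - x₂) + p₂ • (y₁ - y₂))))
            ((⅟(2 : K)) • ((q₁ • (x₁ + x₂) + p₁ • (y₁ + y₂)) - (q₂ • (x₁ - x₂) + p₂ • (y₁ - y₂))))))
    (x₁ x₂ : ι → K) :
    (((doublingDelta T hT * g * (doublingDelta T hT)⁻¹ :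
          symplecticGroup (polar (Matrix.toLinearMap₂' K (Matrix.fromBlocks T 0 0 (-T))))) :
        ((ι ⊕ ι → K) × (ι ⊕ ι → K)) ≃ₗ[K] ((ι ⊕ ι → K) × (ι ⊕ ι → K))).symm (Sum.elim x₁ x₂, 0)).1 =
      Sum.elim (p₂ • x₁ + (d * q₂) • (T⁻¹ *ᵥ x₂)) (q₂ • (T *ᵥ x₁) + p₂ • x₂) := by
  rw [conj_doublingDelta_symm_apply_inl_of_torusShape T hT g hD']

omit [DecidableEq ι] [Invertible (2 : K)] in
/-- bilinear bookkeeping: `β_T(X, Y) := X ⋅ T Y` is symmetric when `T` is. [folklore] -/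
private theorem dotProduct_mulVec_comm (hTs : T.IsSymm) (a c : ι → K) : c ⬝ᵥ (T *ᵥ a) = a ⬝ᵥ (T *ᵥ c) := by
  rw [Matrix.dotProduct_mulVec, ← Matrix.mulVec_transpose, hTs.eq, dotProduct_comm]

include hT in
/-- **THE COBOUNDARY IDENTITY FOR THE TORUS SHAPE** (pure algebra behind (L-D)): with `u = (u₁, T w)`,
`u₁ = p₂ a + d q₂ c`, `w = q₂ a + p₂ c`, and `v = (v₁, T⁻¹ t₂)`, `v₁ = ½((q₁ a − p₁ c) + (q₂ a + p₂ c))`,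
`t₂ = ½((p₁ a − d q₁ c) − (p₂ a + d q₂ c))` — i.e. `(u, v) = (δ d δ⁻¹)⁻¹((a, T c), 0)` — one has
`β_{T⊕−T}(u, v) = u₁ ⋅ T w − a ⋅ T c = q(u) − q(x)` as soon as `U V̄ = 1` (`p₁ p₂ − d q₁ q₂ = 1`, `p₁ q₂ = q₁ p₂`) and `T`
is symmetric: the second-degree character of `δ d δ⁻¹` is the coboundary of `ψ ∘ ½q`, `q(z) = z|₁ ⋅ z|₂`.
[cite: Weil1964, Chap. I n° 13 p. 160] [cite: GelbartPiatetskishapiroRallis1987, Part A §2 pp. 7–9] -/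
theorem form_torusShape (hTs : T.IsSymm) (hUV₁ : p₁ * p₂ - d * q₁ * q₂ = 1) (hUV₂ : p₁ * q₂ = q₁ * p₂) (a c : ι → K) :
    Sum.elim (p₂ • a + (d * q₂) • c) (q₂ • (T *ᵥ a) + p₂ • (T *ᵥ c)) ⬝ᵥ
        (Matrix.fromBlocks T 0 0 (-T) *ᵥ
          Sum.elim ((⅟(2 : K)) • ((q₁ • a + p₁ • (-c)) + (q₂ • a + p₂ • c)))
            (T⁻¹ *ᵥ ((⅟(2 : K)) • ((p₁ • a + (d * q₁) • (-c)) - (p₂ • a + (d * q₂) • c))))) =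
      (p₂ • a + (d * q₂) • c) ⬝ᵥ (q₂ • (T *ᵥ a) + p₂ • (T *ᵥ c)) - a ⬝ᵥ (T *ᵥ c) := by
  rw [Matrix.fromBlocks_mulVec, Sum.elim_comp_inl, Sum.elim_comp_inr, Matrix.zero_mulVec, Matrix.zero_mulVec, add_zero,
    zero_add, sumElim_dotProduct_sumElim, Matrix.neg_mulVec, Matrix.mulVec_mulVec, Matrix.mul_nonsing_inv T hT,
    Matrix.one_mulVec]
  have hca : c ⬝ᵥ (T *ᵥ a) = a ⬝ᵥ (T *ᵥ c) := dotProduct_mulVec_comm T hTs a c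
  have hTa : (T *ᵥ a) ⬝ᵥ a = a ⬝ᵥ (T *ᵥ a) := dotProduct_comm _ _
  have hTc : (T *ᵥ c) ⬝ᵥ c = c ⬝ᵥ (T *ᵥ c) := dotProduct_comm _ _
  have hTac : (T *ᵥ a) ⬝ᵥ c = a ⬝ᵥ (T *ᵥ c) := by rw [dotProduct_comm]; exact hca
  have hTca : (T *ᵥ c) ⬝ᵥ a = a ⬝ᵥ (T *ᵥ c) := dotProduct_comm _ _
  simp only [smul_neg, Matrix.mulVec_add, Matrix.mulVec_smul, Matrix.mulVec_neg, dotProduct_add,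
    dotProduct_sub, dotProduct_neg, dotProduct_smul, add_dotProduct, smul_dotProduct,
    smul_eq_mul, hca, hTa, hTc, hTac, hTca]
  have h2 : (⅟(2 : K)) * 2 = 1 := invOf_mul_self _
  linear_combination (p₂ * q₂ * (a ⬝ᵥ (T *ᵥ a)) + (p₂ ^ 2 + d * q₂ ^ 2) * (a ⬝ᵥ (T *ᵥ c)) +
      d * p₂ * q₂ * (c ⬝ᵥ (T *ᵥ c)) - a ⬝ᵥ (T *ᵥ c)) * h2 -
    (⅟(2 : K)) * (a ⬝ᵥ (T *ᵥ a) + d * (c ⬝ᵥ (T *ᵥ c))) * hUV₂ - 2 * (⅟(2 : K)) * (a ⬝ᵥ (T *ᵥ c)) * hUV₁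

end Torus

end Generic

/-! ## §2 Adelic, renumbered by `finSumFinEquiv`: the parabolic element of a Borel translate and its operator laws -/

section Adelic

variable (F : Type) [Field F] [NumberField F] {n : ℕ}
variable (T : Matrix (Fin n) (Fin n) (AdeleRing (𝓞 F) F)) (hT : IsUnit T.det)

/-! ### Coordinates: vectors of `𝔸^{n+n}` as glued halves `u ∘ e⁻¹`, `u : Fin n ⊕ Fin n → 𝔸`, `e = finSumFinEquiv` -/

/-- `q((A ⊔ B) ∘ e⁻¹) = A ⋅ B` for the split form `q = pairForm` (★ `AdelicDoublingGeometricFrame`). [folklore] -/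
private theorem pairForm_sumElim_comp_symm (A B : Fin n → AdeleRing (𝓞 F) F) :
    pairForm F ((Sum.elim A B) ∘ ⇑(finSumFinEquiv (m := n) (n := n)).symm) = A ⬝ᵥ B := by
  simp only [pairForm, Function.comp_def, finSumFinEquiv_symm_apply_castAdd, finSumFinEquiv_symm_apply_natAdd,
    Sum.elim_inl, Sum.elim_inr]

/-- `q(u ∘ e⁻¹) = u|₁ ⋅ u|₂`. [folklore] -/
private theorem pairForm_comp_symm' (u : Fin n ⊕ Fin n → AdeleRing (𝓞 F) F) :
    pairForm F (u ∘ ⇑(finSumFinEquiv (m := n) (n := n)).symm) = (u ∘ Sum.inl) ⬝ᵥ (u ∘ Sum.inr) := by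
  conv_lhs => rw [← Sum.elim_comp_inl_inr u]
  exact pairForm_sumElim_comp_symm F _ _

/-- every `x : 𝔸^{n+n}` is `(x ∘ e) ∘ e⁻¹`. [folklore] -/
private theorem eq_comp_comp_symm (x : Fin (n + n) → AdeleRing (𝓞 F) F) :
    x = (x ∘ ⇑(finSumFinEquiv (m := n) (n := n))) ∘ ⇑(finSumFinEquiv (m := n) (n := n)).symm := by
  rw [Function.comp_assoc, Equiv.self_comp_symm, Function.comp_id]

/-- `β_𝕋(u ∘ e⁻¹, w ∘ e⁻¹) = u ⋅ (T ⊕ −T) w` (`𝕋 = doubledGramFin = reindex e e (T ⊕ −T)`). [folklore] -/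
private theorem dotProduct_doubledGramFin_mulVec_comp_symm (u w : Fin n ⊕ Fin n → AdeleRing (𝓞 F) F) :
    (u ∘ ⇑(finSumFinEquiv (m := n) (n := n)).symm) ⬝ᵥ (doubledGramFin F T *ᵥ (w ∘ ⇑(finSumFinEquiv (m := n) (n := n)).symm)) =
      u ⬝ᵥ (Matrix.fromBlocks T 0 0 (-T) *ᵥ w) := by
  rw [← Matrix.toLinearMap₂'_apply', doubledGramFin_eq, toLinearMap₂'_reindex, Matrix.toLinearMap₂'_apply']

/-- `q_S(u ∘ e⁻¹) = (u ᵥ* S₀) ⋅ u` for `S = reindex e e S₀`. [folklore] -/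
private theorem sdForm_reindex_comp_symm (S₀ : Matrix (Fin n ⊕ Fin n) (Fin n ⊕ Fin n) (AdeleRing (𝓞 F) F))
    (u : Fin n ⊕ Fin n → AdeleRing (𝓞 F) F) :
    sdForm F (Matrix.reindex finSumFinEquiv finSumFinEquiv S₀) (u ∘ ⇑(finSumFinEquiv (m := n) (n := n)).symm) =
      (u ᵥ* S₀) ⬝ᵥ u := by
  rw [sdForm, Matrix.reindex_apply, Matrix.submatrix_vecMul_equiv, comp_equiv_dotProduct_comp_equiv]
  have h1 : (u ∘ ⇑(finSumFinEquiv (m := n) (n := n)).symm) ∘ ⇑(finSumFinEquiv (m := n) (n := n)).symm.symm = u := by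
    rw [Equiv.symm_symm, Function.comp_assoc, Equiv.symm_comp_self, Function.comp_id]
  rw [h1]

/-- `ψ(q x)·(ψ(t − q x)·c) = ψ(t)·c` (`t = q u`: the coboundary recombination). [folklore] -/
private theorem sdChar_mul_adeleAddChar_sub_mul' {m : ℕ} (S : Matrix (Fin m) (Fin m) (AdeleRing (𝓞 F) F))
    (x : Fin m → AdeleRing (𝓞 F) F) (t : AdeleRing (𝓞 F) F) (c : ℂ) :
    sdChar F S x * ((adeleAddChar F (t - sdForm F S x) : ℂ) * c) = (adeleAddChar F t : ℂ) * c := by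
  rw [← mul_assoc, sdChar, ← Circle.coe_mul, ← AddChar.map_add_eq_mul, add_sub_cancel]

/-! ### The parabolic element `P` with `P = e ∘ (δ g δ⁻¹) ∘ e⁻¹` -/

variable (g : symplecticGroup (polar (Matrix.toLinearMap₂' (AdeleRing (𝓞 F) F) (Matrix.fromBlocks T 0 0 (-T)))))
  (P : siegelParabolicPi (doubledGramFin F T))
  (hP : (P : symplecticGroup (polar (adelicForm F (Fin (n + n)) (doubledGramFin F T)))) =
    spReindex finSumFinEquiv (Matrix.fromBlocks T 0 0 (-T)) (doublingDelta T hT * g * (doublingDelta T hT)⁻¹))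

/-- THE CANONICAL `P`: for `g ∈ Stab(W^Δ)` the element `δ g δ⁻¹ ∈ P_𝕐`, renumbered, is the value of
★ `siegelParabolicPiReindex finSumFinEquiv ∘ stabDiagParabolic` at `g` — it satisfies the hypothesis `hP` of this
section by `rfl`. [cite: Li1992, p. 181] -/
theorem coe_siegelParabolicPiReindex_stabDiagParabolic (hg : g ∈ stabDiag T) :
    ((siegelParabolicPiReindex finSumFinEquiv (Matrix.fromBlocks T 0 0 (-T)) (stabDiagParabolic T hT ⟨g, hg⟩) :
        siegelParabolicPi (doubledGramFin F T)) :
      symplecticGroup (polar (adelicForm F (Fin (n + n)) (doubledGramFin F T)))) =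
      spReindex finSumFinEquiv (Matrix.fromBlocks T 0 0 (-T)) (doublingDelta T hT * g * (doublingDelta T hT)⁻¹) :=
  rfl

include hP in
/-- `P⁻¹ v = e ∘ (δ g δ⁻¹)⁻¹ ∘ e⁻¹ (v)` (renumbering of Li's `δ`-conjugate). [cite: Li1992, p. 181] -/
theorem symm_apply_of_eq_spReindex (v : (Fin (n + n) → AdeleRing (𝓞 F) F) × (Fin (n + n) → AdeleRing (𝓞 F) F)) :
    ((P : symplecticGroup (polar (adelicForm F (Fin (n + n)) (doubledGramFin F T)))) :
        ((Fin (n + n) → AdeleRing (𝓞 F) F) × (Fin (n + n) → AdeleRing (𝓞 F) F)) ≃ₗ[AdeleRing (𝓞 F) F]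
          ((Fin (n + n) → AdeleRing (𝓞 F) F) × (Fin (n + n) → AdeleRing (𝓞 F) F))).symm v =
      reindexW (AdeleRing (𝓞 F) F) finSumFinEquiv
        (((doublingDelta T hT * g * (doublingDelta T hT)⁻¹ :
              symplecticGroup (polar (Matrix.toLinearMap₂' (AdeleRing (𝓞 F) F) (Matrix.fromBlocks T 0 0 (-T))))) :
            ((Fin n ⊕ Fin n → AdeleRing (𝓞 F) F) × (Fin n ⊕ Fin n → AdeleRing (𝓞 F) F)) ≃ₗ[AdeleRing (𝓞 F) F]
              ((Fin n ⊕ Fin n → AdeleRing (𝓞 F) F) × (Fin n ⊕ Fin n → AdeleRing (𝓞 F) F))).symm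
          ((reindexW (AdeleRing (𝓞 F) F) (finSumFinEquiv (m := n) (n := n))).symm v)) := by
  rw [hP]
  rfl

/-! ### (L-N) The unipotent translate acts by a chirp -/

section Unip

variable {b d : AdeleRing (𝓞 F) F}
  (hN' : ∀ x₁ x₂ y₁ y₂ : Fin n → AdeleRing (𝓞 F) F,
    ((g : symplecticGroup (polar (Matrix.toLinearMap₂' (AdeleRing (𝓞 F) F) (Matrix.fromBlocks T 0 0 (-T))))) :
        ((Fin n ⊕ Fin n → AdeleRing (𝓞 F) F) × (Fin n ⊕ Fin n → AdeleRing (𝓞 F) F)) ≃ₗ[AdeleRing (𝓞 F) F]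
          ((Fin n ⊕ Fin n → AdeleRing (𝓞 F) F) × (Fin n ⊕ Fin n → AdeleRing (𝓞 F) F))).symm (Sum.elim x₁ x₂, Sum.elim y₁ y₂) =
      (Sum.elim (x₁ + (d * b) • (y₁ - y₂)) (x₂ + (d * b) • (y₁ - y₂)),
        Sum.elim (y₁ + b • (x₁ - x₂)) (y₂ + b • (x₁ - x₂))))

include hP hN' in
/-- **`P⁻¹(x, 0)` for the unipotent translate** (`x = u ∘ e⁻¹`): `𝕏`-component `x`, `𝕐`-component
`(b u|₁, d b T⁻¹T⁻¹ u|₂) ∘ e⁻¹`. [cite: Weil1964, Chap. I n° 13 p. 160] -/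
theorem symm_apply_inl_of_unipShape (u : Fin n ⊕ Fin n → AdeleRing (𝓞 F) F) :
    ((P : symplecticGroup (polar (adelicForm F (Fin (n + n)) (doubledGramFin F T)))) :
        ((Fin (n + n) → AdeleRing (𝓞 F) F) × (Fin (n + n) → AdeleRing (𝓞 F) F)) ≃ₗ[AdeleRing (𝓞 F) F]
          ((Fin (n + n) → AdeleRing (𝓞 F) F) × (Fin (n + n) → AdeleRing (𝓞 F) F))).symm
        (u ∘ ⇑(finSumFinEquiv (m := n) (n := n)).symm, 0) =
      (u ∘ ⇑(finSumFinEquiv (m := n) (n := n)).symm,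
        (Sum.elim (b • (u ∘ Sum.inl)) ((d * b) • (T⁻¹ *ᵥ (T⁻¹ *ᵥ (u ∘ Sum.inr))))) ∘
          ⇑(finSumFinEquiv (m := n) (n := n)).symm) := by
  rw [symm_apply_of_eq_spReindex F T hT g P hP, reindexW_symm_apply, reindexW_apply]
  dsimp only
  have hu : (u ∘ ⇑(finSumFinEquiv (m := n) (n := n)).symm) ∘ ⇑(finSumFinEquiv (m := n) (n := n)) = u := by
    rw [Function.comp_assoc, Equiv.symm_comp_self, Function.comp_id]
  rw [Pi.zero_comp, hu]
  conv_lhs => rw [← Sum.elim_comp_inl_inr u]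
  rw [conj_doublingDelta_symm_apply_inl_of_unipShape T hT g hN', Sum.elim_comp_inl_inr]

include hT in
/-- the exponent of (L-N): `½ β_𝕋(x, v) = q_{S_b}(x)` for `x = u ∘ e⁻¹`, `v` the `𝕐`-component above and
`S_b = ((½ b T) ⊕ (−½ d b T⁻¹))` renumbered. [cite: Weil1964, Chap. I n° 13 p. 160] -/
theorem half_form_eq_sdForm_of_unipShape (u : Fin n ⊕ Fin n → AdeleRing (𝓞 F) F) :
    ⅟(2 : AdeleRing (𝓞 F) F) *
        ((u ∘ ⇑(finSumFinEquiv (m := n) (n := n)).symm) ⬝ᵥ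
          (doubledGramFin F T *ᵥ
            ((Sum.elim (b • (u ∘ Sum.inl)) ((d * b) • (T⁻¹ *ᵥ (T⁻¹ *ᵥ (u ∘ Sum.inr))))) ∘
              ⇑(finSumFinEquiv (m := n) (n := n)).symm))) =
      sdForm F (Matrix.reindex finSumFinEquiv finSumFinEquiv
          (Matrix.fromBlocks ((⅟(2 : AdeleRing (𝓞 F) F) * b) • T) 0 0
            (-(((⅟(2 : AdeleRing (𝓞 F) F) * (d * b)) • T⁻¹)))))
        (u ∘ ⇑(finSumFinEquiv (m := n) (n := n)).symm) := by
  rw [dotProduct_doubledGramFin_mulVec_comp_symm, sdForm_reindex_comp_symm]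
  conv_lhs => rw [← Sum.elim_comp_inl_inr u]
  conv_rhs => rw [← Sum.elim_comp_inl_inr u]
  simp only [Sum.elim_comp_inl, Sum.elim_comp_inr]
  rw [form_unipShape T hT, Matrix.vecMul_fromBlocks, Sum.elim_comp_inl, Sum.elim_comp_inr, Matrix.vecMul_zero,
    Matrix.vecMul_zero, add_zero, zero_add, sumElim_dotProduct_sumElim, Matrix.vecMul_smul, Matrix.vecMul_neg,
    Matrix.vecMul_smul, smul_dotProduct, neg_dotProduct, smul_dotProduct, ← Matrix.dotProduct_mulVec,
    ← Matrix.dotProduct_mulVec, smul_eq_mul, smul_eq_mul]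
  ring

include hP hN' in
/-- **(L-N) THE UNIPOTENT TRANSLATE ACTS BY A CHIRP**: `(ω(𝐫₀ P)Φ)(x) = ψ_F(q_{S_b}(x)) Φ(x)`, `P = δ g δ⁻¹` renumbered,
`S_b = ((½ b T) ⊕ (−½ d b T⁻¹))` renumbered, i.e. `ω(𝐫₀(δ n δ⁻¹)) Φ = chirp S_b Φ` — Weil's `t₀(f)`; being a chirp it
commutes with the frame chirp `t(C₀)`, so the same law holds for `Φ♮ = t(C₀)Φ`.
[cite: Weil1964, Chap. I n° 13 p. 160] [cite: Weil1965, n° 46 p. 66] -/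
theorem coe_toOp_adelicSiegelLift_of_unipShape (Φ : piSchwartzBruhat F (Fin (n + n))) (x : Fin (n + n) → AdeleRing (𝓞 F) F) :
    ((MpPsi.toOp (adelicSchrodinger F (Fin (n + n)) (doubledGramFin F T))
          (adelicSiegelLift F (doubledGramFin F T) (isUnit_det_doubledGramFin F T hT) P) Φ :
            piSchwartzBruhat F (Fin (n + n))) : (Fin (n + n) → AdeleRing (𝓞 F) F) → ℂ) x =
      chirp F (Matrix.reindex finSumFinEquiv finSumFinEquiv
          (Matrix.fromBlocks ((⅟(2 : AdeleRing (𝓞 F) F) * b) • T) 0 0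
            (-(((⅟(2 : AdeleRing (𝓞 F) F) * (d * b)) • T⁻¹)))))
        (Φ : (Fin (n + n) → AdeleRing (𝓞 F) F) → ℂ) x := by
  rw [eq_comp_comp_symm F x, coe_toOp_adelicSiegelLift_symm,
    symm_apply_inl_of_unipShape F T hT g P hP hN' (x ∘ ⇑finSumFinEquiv)]
  dsimp only
  rw [half_form_eq_sdForm_of_unipShape F T hT, chirp_apply, sdChar]

include hP hN' in
/-- (L-N) at the level of Schwartz–Bruhat vectors: `ω(𝐫₀ P) Φ = chirpLM S_b Φ`. [cite: Weil1964, Chap. I n° 13 p. 160] -/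
theorem toOp_adelicSiegelLift_of_unipShape (Φ : piSchwartzBruhat F (Fin (n + n))) :
    MpPsi.toOp (adelicSchrodinger F (Fin (n + n)) (doubledGramFin F T))
        (adelicSiegelLift F (doubledGramFin F T) (isUnit_det_doubledGramFin F T hT) P) Φ =
      chirpLM F (Matrix.reindex finSumFinEquiv finSumFinEquiv
          (Matrix.fromBlocks ((⅟(2 : AdeleRing (𝓞 F) F) * b) • T) 0 0
            (-(((⅟(2 : AdeleRing (𝓞 F) F) * (d * b)) • T⁻¹))))) Φ :=
  Subtype.ext (funext fun x => (coe_toOp_adelicSiegelLift_of_unipShape F T hT g P hP hN' Φ x).trans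
    (congrFun (coe_chirpLM _ Φ).symm x))

end Unip

/-! ### (L-D) The torus translate acts — in the frame `t(C₀)` — by a pure twist -/

section Torus

variable {p₁ q₁ p₂ q₂ d : AdeleRing (𝓞 F) F}
  (hD' : ∀ x₁ x₂ y₁ y₂ : Fin n → AdeleRing (𝓞 F) F,
    ((g : symplecticGroup (polar (Matrix.toLinearMap₂' (AdeleRing (𝓞 F) F) (Matrix.fromBlocks T 0 0 (-T))))) :
        ((Fin n ⊕ Fin n → AdeleRing (𝓞 F) F) × (Fin n ⊕ Fin n → AdeleRing (𝓞 F) F)) ≃ₗ[AdeleRing (𝓞 F) F]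
          ((Fin n ⊕ Fin n → AdeleRing (𝓞 F) F) × (Fin n ⊕ Fin n → AdeleRing (𝓞 F) F))).symm (Sum.elim x₁ x₂, Sum.elim y₁ y₂) =
      (Sum.elim ((⅟(2 : AdeleRing (𝓞 F) F)) • ((p₁ • (x₁ + x₂) + (d * q₁) • (y₁ + y₂)) + (p₂ • (x₁ - x₂) + (d * q₂) • (y₁ - y₂))))
          ((⅟(2 : AdeleRing (𝓞 F) F)) • ((p₁ • (x₁ + x₂) + (d * q₁) • (y₁ + y₂)) - (p₂ • (x₁ - x₂) + (d * q₂) • (y₁ - y₂)))),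
        Sum.elim ((⅟(2 : AdeleRing (𝓞 F) F)) • ((q₁ • (x₁ + x₂) + p₁ • (y₁ + y₂)) + (q₂ • (x₁ - x₂) + p₂ • (y₁ - y₂))))
          ((⅟(2 : AdeleRing (𝓞 F) F)) • ((q₁ • (x₁ + x₂) + p₁ • (y₁ + y₂)) - (q₂ • (x₁ - x₂) + p₂ • (y₁ - y₂))))))

include hP hD' in
/-- **`P⁻¹(x, 0)` for the torus translate** (`x = u ∘ e⁻¹`): `𝕏`-component `(M_V u) ∘ e⁻¹`,
`M_V u = (p₂ u|₁ + d q₂ T⁻¹ u|₂, q₂ T u|₁ + p₂ u|₂)`, and the `𝕐`-component of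
★ `conj_doublingDelta_symm_apply_inl_of_torusShape`, renumbered. [cite: Weil1964, Chap. I n° 13 p. 160] -/
theorem symm_apply_inl_of_torusShape (u : Fin n ⊕ Fin n → AdeleRing (𝓞 F) F) :
    ((P : symplecticGroup (polar (adelicForm F (Fin (n + n)) (doubledGramFin F T)))) :
        ((Fin (n + n) → AdeleRing (𝓞 F) F) × (Fin (n + n) → AdeleRing (𝓞 F) F)) ≃ₗ[AdeleRing (𝓞 F) F]
          ((Fin (n + n) → AdeleRing (𝓞 F) F) × (Fin (n + n) → AdeleRing (𝓞 F) F))).symm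
        (u ∘ ⇑(finSumFinEquiv (m := n) (n := n)).symm, 0) =
      ((Sum.elim (p₂ • (u ∘ Sum.inl) + (d * q₂) • (T⁻¹ *ᵥ (u ∘ Sum.inr)))
          (q₂ • (T *ᵥ (u ∘ Sum.inl)) + p₂ • (u ∘ Sum.inr))) ∘ ⇑(finSumFinEquiv (m := n) (n := n)).symm,
        (Sum.elim ((⅟(2 : AdeleRing (𝓞 F) F)) • ((q₁ • (u ∘ Sum.inl) + p₁ • (-(T⁻¹ *ᵥ (u ∘ Sum.inr)))) +
            (q₂ • (u ∘ Sum.inl) + p₂ • (T⁻¹ *ᵥ (u ∘ Sum.inr)))))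
          (T⁻¹ *ᵥ ((⅟(2 : AdeleRing (𝓞 F) F)) • ((p₁ • (u ∘ Sum.inl) + (d * q₁) • (-(T⁻¹ *ᵥ (u ∘ Sum.inr)))) -
            (p₂ • (u ∘ Sum.inl) + (d * q₂) • (T⁻¹ *ᵥ (u ∘ Sum.inr))))))) ∘ ⇑(finSumFinEquiv (m := n) (n := n)).symm) := by
  rw [symm_apply_of_eq_spReindex F T hT g P hP, reindexW_symm_apply, reindexW_apply]
  dsimp only
  have hu : (u ∘ ⇑(finSumFinEquiv (m := n) (n := n)).symm) ∘ ⇑(finSumFinEquiv (m := n) (n := n)) = u := by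
    rw [Function.comp_assoc, Equiv.symm_comp_self, Function.comp_id]
  rw [Pi.zero_comp, hu]
  conv_lhs => rw [← Sum.elim_comp_inl_inr u]
  rw [conj_doublingDelta_symm_apply_inl_of_torusShape T hT g hD']

include hT in
/-- the exponent of (L-D): `β_𝕋(u', v) = q(u') − q(x)` for `x = u ∘ e⁻¹`, `(u', v) = P⁻¹(x, 0)` as above, `q = pairForm` —
THE COBOUNDARY (needs `U V̄ = 1` and `T` symmetric). [cite: Weil1964, Chap. I n° 13 p. 160]
[cite: GelbartPiatetskishapiroRallis1987, Part A §2 pp. 7–9] -/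
theorem form_eq_pairForm_sub_of_torusShape (hTs : T.IsSymm) (hUV₁ : p₁ * p₂ - d * q₁ * q₂ = 1) (hUV₂ : p₁ * q₂ = q₁ * p₂)
    (u : Fin n ⊕ Fin n → AdeleRing (𝓞 F) F) :
    ((Sum.elim (p₂ • (u ∘ Sum.inl) + (d * q₂) • (T⁻¹ *ᵥ (u ∘ Sum.inr)))
          (q₂ • (T *ᵥ (u ∘ Sum.inl)) + p₂ • (u ∘ Sum.inr))) ∘ ⇑(finSumFinEquiv (m := n) (n := n)).symm) ⬝ᵥ
        (doubledGramFin F T *ᵥ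
          ((Sum.elim ((⅟(2 : AdeleRing (𝓞 F) F)) • ((q₁ • (u ∘ Sum.inl) + p₁ • (-(T⁻¹ *ᵥ (u ∘ Sum.inr)))) +
              (q₂ • (u ∘ Sum.inl) + p₂ • (T⁻¹ *ᵥ (u ∘ Sum.inr)))))
            (T⁻¹ *ᵥ ((⅟(2 : AdeleRing (𝓞 F) F)) • ((p₁ • (u ∘ Sum.inl) + (d * q₁) • (-(T⁻¹ *ᵥ (u ∘ Sum.inr)))) -
              (p₂ • (u ∘ Sum.inl) + (d * q₂) • (T⁻¹ *ᵥ (u ∘ Sum.inr))))))) ∘ ⇑(finSumFinEquiv (m := n) (n := n)).symm)) =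
      pairForm F ((Sum.elim (p₂ • (u ∘ Sum.inl) + (d * q₂) • (T⁻¹ *ᵥ (u ∘ Sum.inr)))
          (q₂ • (T *ᵥ (u ∘ Sum.inl)) + p₂ • (u ∘ Sum.inr))) ∘ ⇑(finSumFinEquiv (m := n) (n := n)).symm) -
        pairForm F (u ∘ ⇑(finSumFinEquiv (m := n) (n := n)).symm) := by
  rw [dotProduct_doubledGramFin_mulVec_comp_symm, pairForm_sumElim_comp_symm, pairForm_comp_symm']
  have hc : T *ᵥ (T⁻¹ *ᵥ (u ∘ Sum.inr)) = u ∘ Sum.inr := by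
    rw [Matrix.mulVec_mulVec, Matrix.mul_nonsing_inv T hT, Matrix.one_mulVec]
  have h := form_torusShape T hT hTs hUV₁ hUV₂ (u ∘ Sum.inl) (T⁻¹ *ᵥ (u ∘ Sum.inr))
  rw [hc] at h
  exact h

include hP hD' in
/-- **(L-D), INTRINSIC FORM**: `(ω(𝐫₀ P)Φ)(x) = ψ_F(½(q(M_V x) − q(x))) · Φ(M_V x)` for the torus translate, `q = pairForm`,
`M_V x = (p₂ x|₁ + d q₂ T⁻¹ x|₂, q₂ T x|₁ + p₂ x|₂)` renumbered (`x = u ∘ e⁻¹`). [cite: Weil1964, Chap. I n° 13 p. 160] -/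
theorem coe_toOp_adelicSiegelLift_of_torusShape (hTs : T.IsSymm) (hUV₁ : p₁ * p₂ - d * q₁ * q₂ = 1) (hUV₂ : p₁ * q₂ = q₁ * p₂)
    (Φ : piSchwartzBruhat F (Fin (n + n))) (u : Fin n ⊕ Fin n → AdeleRing (𝓞 F) F) :
    ((MpPsi.toOp (adelicSchrodinger F (Fin (n + n)) (doubledGramFin F T))
          (adelicSiegelLift F (doubledGramFin F T) (isUnit_det_doubledGramFin F T hT) P) Φ :
            piSchwartzBruhat F (Fin (n + n))) : (Fin (n + n) → AdeleRing (𝓞 F) F) → ℂ)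
        (u ∘ ⇑(finSumFinEquiv (m := n) (n := n)).symm) =
      (adeleAddChar F (⅟(2 : AdeleRing (𝓞 F) F) *
          (pairForm F ((Sum.elim (p₂ • (u ∘ Sum.inl) + (d * q₂) • (T⁻¹ *ᵥ (u ∘ Sum.inr)))
              (q₂ • (T *ᵥ (u ∘ Sum.inl)) + p₂ • (u ∘ Sum.inr))) ∘ ⇑(finSumFinEquiv (m := n) (n := n)).symm) -
            pairForm F (u ∘ ⇑(finSumFinEquiv (m := n) (n := n)).symm))) : ℂ) *
        (Φ : (Fin (n + n) → AdeleRing (𝓞 F) F) → ℂ)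
          ((Sum.elim (p₂ • (u ∘ Sum.inl) + (d * q₂) • (T⁻¹ *ᵥ (u ∘ Sum.inr)))
              (q₂ • (T *ᵥ (u ∘ Sum.inl)) + p₂ • (u ∘ Sum.inr))) ∘ ⇑(finSumFinEquiv (m := n) (n := n)).symm) := by
  rw [coe_toOp_adelicSiegelLift_symm, symm_apply_inl_of_torusShape F T hT g P hP hD' u]
  dsimp only
  rw [form_eq_pairForm_sub_of_torusShape F T hT hTs hUV₁ hUV₂ u]

include hP hD' in
/-- **(L-D) THE TORUS TRANSLATE ACTS, IN THE FRAME, BY A PURE TWIST**: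
`ψ_F(½q(x)) · (ω(𝐫₀ P)Φ)(x) = ψ_F(½q(M_V x)) · Φ(M_V x)`, i.e. `t(C₀) ∘ ω(𝐫₀(δ d δ⁻¹)) = (· ∘ M_V) ∘ t(C₀)` with the frame chirp
`t(C₀)`, `C₀ = frameHalfRat` (★ `sdForm_frameHalf`: `q_{C₀} = ½ q`) — NO chirp, NO phase on the frame side (Weil's
`d₀(α)⁻¹ t₀(f) d₀(α) = t₀(f^α)` for the coboundary). [cite: Weil1964, Chap. I n° 13 p. 160] [cite: Weil1965, n° 46 p. 66] -/
theorem chirp_frameHalf_toOp_adelicSiegelLift_of_torusShape (hTs : T.IsSymm) (hUV₁ : p₁ * p₂ - d * q₁ * q₂ = 1)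
    (hUV₂ : p₁ * q₂ = q₁ * p₂) (Φ : piSchwartzBruhat F (Fin (n + n))) (u : Fin n ⊕ Fin n → AdeleRing (𝓞 F) F) :
    chirp F (ratMatrix F (frameHalfRat F))
        ((MpPsi.toOp (adelicSchrodinger F (Fin (n + n)) (doubledGramFin F T))
          (adelicSiegelLift F (doubledGramFin F T) (isUnit_det_doubledGramFin F T hT) P) Φ :
            piSchwartzBruhat F (Fin (n + n))) : (Fin (n + n) → AdeleRing (𝓞 F) F) → ℂ)
        (u ∘ ⇑(finSumFinEquiv (m := n) (n := n)).symm) =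
      chirp F (ratMatrix F (frameHalfRat F)) (Φ : (Fin (n + n) → AdeleRing (𝓞 F) F) → ℂ)
        ((Sum.elim (p₂ • (u ∘ Sum.inl) + (d * q₂) • (T⁻¹ *ᵥ (u ∘ Sum.inr)))
            (q₂ • (T *ᵥ (u ∘ Sum.inl)) + p₂ • (u ∘ Sum.inr))) ∘ ⇑(finSumFinEquiv (m := n) (n := n)).symm) := by
  have e : ⅟(2 : AdeleRing (𝓞 F) F) *
      (pairForm F ((Sum.elim (p₂ • (u ∘ Sum.inl) + (d * q₂) • (T⁻¹ *ᵥ (u ∘ Sum.inr)))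
          (q₂ • (T *ᵥ (u ∘ Sum.inl)) + p₂ • (u ∘ Sum.inr))) ∘ ⇑(finSumFinEquiv (m := n) (n := n)).symm) -
        pairForm F (u ∘ ⇑(finSumFinEquiv (m := n) (n := n)).symm)) =
      sdForm F (ratMatrix F (frameHalfRat F))
          ((Sum.elim (p₂ • (u ∘ Sum.inl) + (d * q₂) • (T⁻¹ *ᵥ (u ∘ Sum.inr)))
              (q₂ • (T *ᵥ (u ∘ Sum.inl)) + p₂ • (u ∘ Sum.inr))) ∘ ⇑(finSumFinEquiv (m := n) (n := n)).symm) -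
        sdForm F (ratMatrix F (frameHalfRat F)) (u ∘ ⇑(finSumFinEquiv (m := n) (n := n)).symm) := by
    rw [sdForm_frameHalf, sdForm_frameHalf, mul_sub]
  rw [chirp_apply, chirp_apply, coe_toOp_adelicSiegelLift_of_torusShape F T hT g P hP hD' hTs hUV₁ hUV₂ Φ u, e]
  exact sdChar_mul_adeleAddChar_sub_mul' F _ _ _ _

include hP hD' in
/-- (L-D) for an arbitrary `x : 𝔸^{n+n}` (`u := x ∘ e`): `ψ_F(½q(x))·(ω(𝐫₀ P)Φ)(x) = (t(C₀)Φ)((M_V (x ∘ e)) ∘ e⁻¹)`.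
[cite: Weil1964, Chap. I n° 13 p. 160] -/
theorem chirp_frameHalf_toOp_adelicSiegelLift_of_torusShape' (hTs : T.IsSymm) (hUV₁ : p₁ * p₂ - d * q₁ * q₂ = 1)
    (hUV₂ : p₁ * q₂ = q₁ * p₂) (Φ : piSchwartzBruhat F (Fin (n + n))) (x : Fin (n + n) → AdeleRing (𝓞 F) F) :
    chirp F (ratMatrix F (frameHalfRat F))
        ((MpPsi.toOp (adelicSchrodinger F (Fin (n + n)) (doubledGramFin F T))
          (adelicSiegelLift F (doubledGramFin F T) (isUnit_det_doubledGramFin F T hT) P) Φ :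
            piSchwartzBruhat F (Fin (n + n))) : (Fin (n + n) → AdeleRing (𝓞 F) F) → ℂ) x =
      chirp F (ratMatrix F (frameHalfRat F)) (Φ : (Fin (n + n) → AdeleRing (𝓞 F) F) → ℂ)
        ((Sum.elim (p₂ • ((x ∘ ⇑(finSumFinEquiv (m := n) (n := n))) ∘ Sum.inl) +
              (d * q₂) • (T⁻¹ *ᵥ ((x ∘ ⇑(finSumFinEquiv (m := n) (n := n))) ∘ Sum.inr)))
            (q₂ • (T *ᵥ ((x ∘ ⇑(finSumFinEquiv (m := n) (n := n))) ∘ Sum.inl)) +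
              p₂ • ((x ∘ ⇑(finSumFinEquiv (m := n) (n := n))) ∘ Sum.inr))) ∘ ⇑(finSumFinEquiv (m := n) (n := n)).symm) := by
  conv_lhs => rw [eq_comp_comp_symm F x]
  exact chirp_frameHalf_toOp_adelicSiegelLift_of_torusShape F T hT g P hP hD' hTs hUV₁ hUV₂ Φ (x ∘ ⇑finSumFinEquiv)

omit hT in
/-- the row-vector form of `M_V`: `x ᵥ* M_Vᵀ♮ = (M_V (x ∘ e)) ∘ e⁻¹` for the renumbered transpose
`M_Vᵀ♮ = reindex e e [[p₂, q₂ T], [d q₂ T⁻¹, p₂]]` (`T` symmetric) — the matrix of Weil's `d₀(α)` for the torus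
translate in the frame. [cite: Weil1964, Chap. I n° 13 p. 160] -/
theorem vecMul_torusTwist (hTs : T.IsSymm) (M : GL (Fin (n + n)) (AdeleRing (𝓞 F) F))
    (hM : (M : Matrix (Fin (n + n)) (Fin (n + n)) (AdeleRing (𝓞 F) F)) =
      Matrix.reindex finSumFinEquiv finSumFinEquiv
        (Matrix.fromBlocks (p₂ • (1 : Matrix (Fin n) (Fin n) (AdeleRing (𝓞 F) F))) (q₂ • T) ((d * q₂) • T⁻¹)
          (p₂ • (1 : Matrix (Fin n) (Fin n) (AdeleRing (𝓞 F) F)))))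
    (x : Fin (n + n) → AdeleRing (𝓞 F) F) :
    x ᵥ* (M : Matrix (Fin (n + n)) (Fin (n + n)) (AdeleRing (𝓞 F) F)) =
      (Sum.elim (p₂ • ((x ∘ ⇑(finSumFinEquiv (m := n) (n := n))) ∘ Sum.inl) +
            (d * q₂) • (T⁻¹ *ᵥ ((x ∘ ⇑(finSumFinEquiv (m := n) (n := n))) ∘ Sum.inr)))
          (q₂ • (T *ᵥ ((x ∘ ⇑(finSumFinEquiv (m := n) (n := n))) ∘ Sum.inl)) +
            p₂ • ((x ∘ ⇑(finSumFinEquiv (m := n) (n := n))) ∘ Sum.inr))) ∘ ⇑(finSumFinEquiv (m := n) (n := n)).symm := by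
  have h1 : ∀ v : Fin n → AdeleRing (𝓞 F) F, v ᵥ* T = T *ᵥ v := fun v => by
    rw [← Matrix.vecMul_transpose, hTs.eq]
  have h2 : ∀ v : Fin n → AdeleRing (𝓞 F) F, v ᵥ* T⁻¹ = T⁻¹ *ᵥ v := fun v => by
    rw [← Matrix.vecMul_transpose, hTs.inv.eq]
  rw [hM, Matrix.reindex_apply, Matrix.submatrix_vecMul_equiv, Matrix.vecMul_fromBlocks]
  have hx : (x ∘ ⇑(finSumFinEquiv (m := n) (n := n)).symm.symm) = x ∘ ⇑(finSumFinEquiv (m := n) (n := n)) := by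
    rw [Equiv.symm_symm]
  rw [hx]
  simp only [Matrix.vecMul_smul, Matrix.vecMul_one, h1, h2]

include hP hD' in
/-- **(L-D) AS A TWIST**: `t(C₀) (ω(𝐫₀ P) Φ) = twist M_Vᵀ♮ (t(C₀) Φ)` — `t(C₀) ∘ ω(𝐫₀(δ d δ⁻¹)) = twistLM (M_Vᵀ♮) ∘ t(C₀)`
for ANY invertible matrix `M` whose entries are `reindex e e [[p₂, q₂ T], [d q₂ T⁻¹, p₂]]` (the consumer supplies its own `GL`
element, e.g. a diagonal-model torus element on the real ray): IN THE FRAME THE TORUS ACTS BY A PURE TWIST.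
[cite: Weil1964, Chap. I n° 13 p. 160] [cite: Weil1965, n° 46 p. 66] -/
theorem chirp_frameHalf_toOp_adelicSiegelLift_eq_twist_of_torusShape (hTs : T.IsSymm) (hUV₁ : p₁ * p₂ - d * q₁ * q₂ = 1)
    (hUV₂ : p₁ * q₂ = q₁ * p₂) (M : GL (Fin (n + n)) (AdeleRing (𝓞 F) F))
    (hM : (M : Matrix (Fin (n + n)) (Fin (n + n)) (AdeleRing (𝓞 F) F)) =
      Matrix.reindex finSumFinEquiv finSumFinEquiv
        (Matrix.fromBlocks (p₂ • (1 : Matrix (Fin n) (Fin n) (AdeleRing (𝓞 F) F))) (q₂ • T) ((d * q₂) • T⁻¹)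
          (p₂ • (1 : Matrix (Fin n) (Fin n) (AdeleRing (𝓞 F) F)))))
    (Φ : piSchwartzBruhat F (Fin (n + n))) :
    chirp F (ratMatrix F (frameHalfRat F))
        ((MpPsi.toOp (adelicSchrodinger F (Fin (n + n)) (doubledGramFin F T))
          (adelicSiegelLift F (doubledGramFin F T) (isUnit_det_doubledGramFin F T hT) P) Φ :
            piSchwartzBruhat F (Fin (n + n))) : (Fin (n + n) → AdeleRing (𝓞 F) F) → ℂ) =
      twist F M (chirp F (ratMatrix F (frameHalfRat F)) (Φ : (Fin (n + n) → AdeleRing (𝓞 F) F) → ℂ)) := by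
  funext x
  have h := chirp_frameHalf_toOp_adelicSiegelLift_of_torusShape' F T hT g P hP hD' hTs hUV₁ hUV₂ Φ x
  refine h.trans ?_
  rw [twist_apply, vecMul_torusTwist F T hTs M hM x]

include hP hD' in
/-- (L-D) as a twist, at the level of Schwartz–Bruhat vectors: `chirpLM C₀ (ω(𝐫₀ P) Φ) = twistLM M (chirpLM C₀ Φ)`.
[cite: Weil1964, Chap. I n° 13 p. 160] -/
theorem chirpLM_frameHalf_toOp_adelicSiegelLift_of_torusShape (hTs : T.IsSymm) (hUV₁ : p₁ * p₂ - d * q₁ * q₂ = 1)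
    (hUV₂ : p₁ * q₂ = q₁ * p₂) (M : GL (Fin (n + n)) (AdeleRing (𝓞 F) F))
    (hM : (M : Matrix (Fin (n + n)) (Fin (n + n)) (AdeleRing (𝓞 F) F)) =
      Matrix.reindex finSumFinEquiv finSumFinEquiv
        (Matrix.fromBlocks (p₂ • (1 : Matrix (Fin n) (Fin n) (AdeleRing (𝓞 F) F))) (q₂ • T) ((d * q₂) • T⁻¹)
          (p₂ • (1 : Matrix (Fin n) (Fin n) (AdeleRing (𝓞 F) F)))))
    (Φ : piSchwartzBruhat F (Fin (n + n))) :
    chirpLM F (ratMatrix F (frameHalfRat F))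
        (MpPsi.toOp (adelicSchrodinger F (Fin (n + n)) (doubledGramFin F T))
          (adelicSiegelLift F (doubledGramFin F T) (isUnit_det_doubledGramFin F T hT) P) Φ) =
      twistLM F M (chirpLM F (ratMatrix F (frameHalfRat F)) Φ) :=
  Subtype.ext (chirp_frameHalf_toOp_adelicSiegelLift_eq_twist_of_torusShape F T hT g P hP hD' hTs hUV₁ hUV₂ M hM Φ)

end Torus

/-! ### (L-D) on the REAL RAY: a real scalar torus element (`q₁ = q₂ = 0`, `p₁ p₂ = 1`) acts in the frame by the dilation `p₂` -/

section RealRay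

variable {p₁ p₂ : AdeleRing (𝓞 F) F}
  (hR' : ∀ x₁ x₂ y₁ y₂ : Fin n → AdeleRing (𝓞 F) F,
    ((g : symplecticGroup (polar (Matrix.toLinearMap₂' (AdeleRing (𝓞 F) F) (Matrix.fromBlocks T 0 0 (-T))))) :
        ((Fin n ⊕ Fin n → AdeleRing (𝓞 F) F) × (Fin n ⊕ Fin n → AdeleRing (𝓞 F) F)) ≃ₗ[AdeleRing (𝓞 F) F]
          ((Fin n ⊕ Fin n → AdeleRing (𝓞 F) F) × (Fin n ⊕ Fin n → AdeleRing (𝓞 F) F))).symm (Sum.elim x₁ x₂, Sum.elim y₁ y₂) =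
      (Sum.elim ((⅟(2 : AdeleRing (𝓞 F) F)) • (p₁ • (x₁ + x₂) + p₂ • (x₁ - x₂)))
          ((⅟(2 : AdeleRing (𝓞 F) F)) • (p₁ • (x₁ + x₂) - p₂ • (x₁ - x₂))),
        Sum.elim ((⅟(2 : AdeleRing (𝓞 F) F)) • (p₁ • (y₁ + y₂) + p₂ • (y₁ - y₂)))
          ((⅟(2 : AdeleRing (𝓞 F) F)) • (p₁ • (y₁ + y₂) - p₂ • (y₁ - y₂)))))

include hR' in
omit hT in
/-- a real-scalar torus element has the torus shape with `q₁ = q₂ = 0` (any `d`). [folklore] -/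
private theorem torusShape_of_realRay (x₁ x₂ y₁ y₂ : Fin n → AdeleRing (𝓞 F) F) :
    ((g : symplecticGroup (polar (Matrix.toLinearMap₂' (AdeleRing (𝓞 F) F) (Matrix.fromBlocks T 0 0 (-T))))) :
        ((Fin n ⊕ Fin n → AdeleRing (𝓞 F) F) × (Fin n ⊕ Fin n → AdeleRing (𝓞 F) F)) ≃ₗ[AdeleRing (𝓞 F) F]
          ((Fin n ⊕ Fin n → AdeleRing (𝓞 F) F) × (Fin n ⊕ Fin n → AdeleRing (𝓞 F) F))).symm (Sum.elim x₁ x₂, Sum.elim y₁ y₂) =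
      (Sum.elim ((⅟(2 : AdeleRing (𝓞 F) F)) • ((p₁ • (x₁ + x₂) + ((0 : AdeleRing (𝓞 F) F) * 0) • (y₁ + y₂)) +
            (p₂ • (x₁ - x₂) + ((0 : AdeleRing (𝓞 F) F) * 0) • (y₁ - y₂))))
          ((⅟(2 : AdeleRing (𝓞 F) F)) • ((p₁ • (x₁ + x₂) + ((0 : AdeleRing (𝓞 F) F) * 0) • (y₁ + y₂)) -
            (p₂ • (x₁ - x₂) + ((0 : AdeleRing (𝓞 F) F) * 0) • (y₁ - y₂)))),
        Sum.elim ((⅟(2 : AdeleRing (𝓞 F) F)) • (((0 : AdeleRing (𝓞 F) F) • (x₁ + x₂) + p₁ • (y₁ + y₂)) +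
            ((0 : AdeleRing (𝓞 F) F) • (x₁ - x₂) + p₂ • (y₁ - y₂))))
          ((⅟(2 : AdeleRing (𝓞 F) F)) • (((0 : AdeleRing (𝓞 F) F) • (x₁ + x₂) + p₁ • (y₁ + y₂)) -
            ((0 : AdeleRing (𝓞 F) F) • (x₁ - x₂) + p₂ • (y₁ - y₂))))) := by
  rw [hR']
  simp only [mul_zero, zero_smul, add_zero, zero_add]

include hP hR' in
/-- **(L-D) ON THE REAL RAY**: if `g⁻¹` acts by the scalar `p₁` on `W^Δ` and `p₂` on `W^∇` with `p₁ p₂ = 1` (the torus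
element `d_U(t)`, `t` a REAL idele — the only case the Siegel–Weil boundedness step uses), then
`ψ_F(½q(x))·(ω(𝐫₀ P)Φ)(x) = (t(C₀)Φ)(p₂ • x)`: in the frame the real torus ray acts by the DILATION `x ↦ p₂ x`
(`= twist (p₂ • 1)`, Weil's `d₀` of a scalar; `l2Scaling = |p₂|_𝔸^{…}` by ★ `l2Scaling_leviPair`). [cite: Weil1964, Chap. I n° 13 p. 160]
[cite: Weil1965, n° 47 Lemma 20 and n° 50] -/
theorem chirp_frameHalf_toOp_adelicSiegelLift_of_realRay (hTs : T.IsSymm) (hp : p₁ * p₂ = 1)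
    (Φ : piSchwartzBruhat F (Fin (n + n))) (x : Fin (n + n) → AdeleRing (𝓞 F) F) :
    chirp F (ratMatrix F (frameHalfRat F))
        ((MpPsi.toOp (adelicSchrodinger F (Fin (n + n)) (doubledGramFin F T))
          (adelicSiegelLift F (doubledGramFin F T) (isUnit_det_doubledGramFin F T hT) P) Φ :
            piSchwartzBruhat F (Fin (n + n))) : (Fin (n + n) → AdeleRing (𝓞 F) F) → ℂ) x =
      chirp F (ratMatrix F (frameHalfRat F)) (Φ : (Fin (n + n) → AdeleRing (𝓞 F) F) → ℂ) (p₂ • x) := by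
  have h := chirp_frameHalf_toOp_adelicSiegelLift_of_torusShape' F T hT g P hP (d := 0)
    (torusShape_of_realRay F T g hR') hTs (by rw [hp]; ring) (by ring) Φ x
  rw [h]
  congr 1
  simp only [mul_zero, zero_smul, add_zero, zero_add]
  have key : ∀ v : Fin n ⊕ Fin n → AdeleRing (𝓞 F) F,
      Sum.elim (p₂ • (v ∘ Sum.inl)) (p₂ • (v ∘ Sum.inr)) = p₂ • v := fun v => by
    funext i
    rcases i with i | i <;> rfl
  rw [key]
  exact congrArg (fun w : Fin (n + n) → AdeleRing (𝓞 F) F => p₂ • w) (eq_comp_comp_symm F x).symm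

end RealRay

/-! ### The same laws in the metaplectic group of record `Mp_ψ(W_𝔸)ᶜᵒⁿᵗ` (`adelicSiegelLiftCont`, `adelicMpCont.omega`) -/

/-- `ω(𝐫₀ᶜᵒⁿᵗ P) = toOp (𝐫₀ P)`: Weil's `𝐫₀` read in the metaplectic group of record (the carrier is only restricted).
[cite: Weil1964, Chap. I n° 13 p. 160] -/
theorem omega_adelicSiegelLiftCont_apply (P : siegelParabolicPi (doubledGramFin F T)) (Φ : piSchwartzBruhat F (Fin (n + n))) :
    adelicMpCont.omega F (Fin (n + n)) (doubledGramFin F T)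
        (adelicSiegelLiftCont F (doubledGramFin F T) (isUnit_det_doubledGramFin F T hT) P) Φ =
      MpPsi.toOp (adelicSchrodinger F (Fin (n + n)) (doubledGramFin F T))
        (adelicSiegelLift F (doubledGramFin F T) (isUnit_det_doubledGramFin F T hT) P) Φ :=
  rfl


end Adelic

end Literature.NumberTheory.Weil1964
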